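import Literature.AlgebraicGeometry.Motives.ProjectiveLineUniformisers
import Literature.AlgebraicGeometry.Motives.FamilyFiberCycleOrd
import Literature.AlgebraicGeometry.Motives.FamilyFiberCyclePushforward
import Literature.AlgebraicGeometry.Motives.CyclesGraphClosure
import Literature.AlgebraicGeometry.Motives.CyclesPushforwardRelDimOne
import Literature.AlgebraicGeometry.Motives.CyclesPrincipalDivisorProofs
import Literature.AlgebraicGeometry.Motives.CyclesDimensionFunctionField
import Literature.AlgebraicGeometry.Motives.CyclesDivisorDimensionProofs
import Literature.AlgebraicGeometry.Motives.FlatOverSmoothCurve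
import Literature.AlgebraicGeometry.Motives.SubschemeCyclesFundamentalProofs
import Literature.AlgebraicGeometry.Motives.AbelianVarietyKernelComponent
import HarnessLib

/-!
# `Rat_d X ≤ Alg_d X` (Fulton, *Intersection Theory*, Prop. 1.6, §1.6, Example 10.3.2)

The discharge `ratTrivial_le_algTrivial_holds` of the named fact
`Literature.AlgebraicGeometry.Motives.ratTrivial_le_algTrivial` of `Motives/AlgebraicEquivalence`:
on a scheme `X` locally of finite type over a field `k`, the group `Rat_d X` of `d`-cycles
rationally equivalent to zero is contained in the group `Alg_d X` of `d`-cycles algebraically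
equivalent to zero (generated by differences `[W_{t₀}] - [W_{t₁}]` of fibres of flat families
`W ⊆ X ×ₖ T` over smooth integral curves `T` at rational points).

We follow the printed proof of Fulton's Prop. 1.6 ("`α` is rationally equivalent to zero iff
`α = Σ [Vᵢ(0)] - [Vᵢ(∞)]` for subvarieties `Vᵢ ⊆ X × ℙ¹` projecting dominantly to `ℙ¹`"), in the
direction needed: let `[div(f)]`, `f ∈ R(V)^*`, `V ⊆ X` a subvariety of dimension `d + 1`, be a
generator of `Rat_d X`.

* If `f` is algebraic over `k`, every order of vanishing `ord_v(f)` is zero (the algebraic case of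
  Prop. 1.4 (a): `𝒪_{V,v}[f]` is finite over `𝒪_{V,v}` and `f` is a unit in it,
  `Literature.AlgebraicGeometry.Motives.ordFrac_eq_one_of_isAlgebraic`), so the generator is `0`.
* If `f` is transcendental over `k`, it defines a dominant rational map `V ⇢ ℙ¹`; let `W ⊆ X × ℙ¹`
  be the closure of its graph (`Literature.AlgebraicGeometry.Motives.exists_graphClosure` gives the
  closure abstractly with `π : W' → V` proper birational and `ψ : W' → ℙ¹`, `ψ^♯ t = π^♯ f`; we take
  the scheme-theoretic image `W` of `(π, ψ) : W' → X × ℙ¹`, `RatAlgData.W`). The projection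
  `p : W → V` is proper and birational and `g = pr₂ : W → ℙ¹` is dominant, hence flat
  (`flat_of_isDominant_of_smoothCurve`), with `g^♯ t = p^♯ f` (`RatAlgData.φ_eq`). Then
  `[div(f)] = p_*[div(p^♯ f)]` (Prop. 1.4 (b) = Stacks 02RT for the birational `p`: the norm of
  `p^♯ f` is `f`, `map_div_eq_div_norm_holds`; `RatAlgData.map_p_cW`), and
  `p_*[div(g^♯ t)] = [W_0] - [W_∞]` in `Z_d X`, `0 = (1:0)`, `∞ = (0:1)`: by Example 1.5.1 the
  multiplicities of the Cartier divisors `W_0 = g⁻¹(0)`, `W_∞ = g⁻¹(∞)` are the orders of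
  vanishing of `g^♯ t`, resp. minus those of `g^♯ t⁻¹ ` (`t`, `t⁻¹` being uniformisers at `0`, `∞`,
  `Motives/ProjectiveLineUniformisers`; local identity `Motives/FamilyFiberCycleOrd`), `g^♯ t` is a
  unit over every other point of `ℙ¹`, and `pr₁` maps the fibres isomorphically onto their images
  (§1.6, `p_*[f⁻¹(P)] = [Y(P)]`; bookkeeping `Motives/FamilyFiberCyclePushforward`). So the
  generator is the generator `[W_0] - [W_∞]` of `Alg_d X` (Example 10.3.2, `T = ℙ¹`).

Everything here is proved; the data of the construction are bundled in `RatAlgData`.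

## References

* [Fulton1998] W. Fulton, *Intersection Theory*, 2nd ed. (1998), Prop. 1.4, Example 1.5.1, §1.6,
  Prop. 1.6, §10.3, Example 10.3.2.
* [StacksProject] The Stacks Project, Tag 02RT (Lemma 42.18.1), Tag 02S2.
-/

open CategoryTheory AlgebraicGeometry Limits IsLocalRing TopologicalSpace Order
open Literature.AlgebraicGeometry.Motives

universe u

noncomputable section
namespace Literature.AlgebraicGeometry.Motives

namespace RatLeAlg

/-! ### Orders of vanishing: units, inverses, rational functions algebraic over the base field -/

/-- The image in `K(Z)` of a unit of `𝒪_{Z,z}` has order of vanishing `0` at `z`. [folklore] -/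
theorem ord_algebraMap_of_isUnit {Z : Scheme.{u}} [IsIntegral Z] [IsLocallyNoetherian Z] {z : Z}
    (u : Z.presheaf.stalk z) (hu : IsUnit u) :
    Scheme.ord (algebraMap (Z.presheaf.stalk z) Z.functionField u) z = 0 := by
  by_cases hzc : coheight z = 1
  swap
  · exact Scheme.ord_eq_zero_of_coheight_neq_one hzc _
  haveI : Ring.KrullDimLE 1 (Z.presheaf.stalk z) := krullDimLE_of_coheight_le hzc.le
  rw [ord_eq_toAdd_ordFrac hzc, Ring.ordFrac_of_isUnit hu]
  rfl

/-- `ord_z 1 = 0`. [folklore] -/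
theorem ord_one {Z : Scheme.{u}} [IsIntegral Z] [IsLocallyNoetherian Z] (z : Z) :
    Scheme.ord (1 : Z.functionField) z = 0 := by
  have h := Scheme.ord_mul (x := z) (one_ne_zero (α := Z.functionField)) one_ne_zero
  rw [mul_one] at h
  omega

/-- `ord_z (φ⁻¹) = - ord_z φ`. [folklore] -/
theorem ord_inv {Z : Scheme.{u}} [IsIntegral Z] [IsLocallyNoetherian Z] {φ : Z.functionField}
    (hφ : φ ≠ 0) (z : Z) : Scheme.ord φ⁻¹ z = - Scheme.ord φ z := by
  have h := Scheme.ord_mul (x := z) hφ (inv_ne_zero hφ)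
  rw [mul_inv_cancel₀ hφ, ord_one] at h
  omega

/-- **Fulton, Prop. 1.4 (a), case "`r` algebraic" over the base field**: on an integral scheme
`X → Spec k`, a non-zero rational function algebraic over `k` has all orders of vanishing zero
(`Literature.AlgebraicGeometry.Motives.ordFrac_eq_one_of_isAlgebraic`: `𝒪_{X,x}[f]` is finite
over `𝒪_{X,x}` with `f` a unit). [cite: Fulton1998, Prop. 1.4 (a), proof] -/
theorem ord_eq_zero_of_isAlgebraic_base {k : Type u} [Field k] {X : Scheme.{u}} [IsIntegral X]
    [IsLocallyNoetherian X] (fX : X ⟶ Spec (.of k)) (f : X.functionField) (hf : f ≠ 0)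
    (halg : letI := ((X.presheaf.germ ⊤ (genericPoint X) trivial).hom.comp
        (fX.appTop.hom.comp (Scheme.ΓSpecIso (.of k)).inv.hom)).toAlgebra
      IsAlgebraic k f) (x : X) : Scheme.ord f x = 0 := by
  by_cases hxc : coheight x = 1
  swap
  · exact Scheme.ord_eq_zero_of_coheight_neq_one hxc f
  letI algL : Algebra k X.functionField := ((X.presheaf.germ ⊤ (genericPoint X) trivial).hom.comp
    (fX.appTop.hom.comp (Scheme.ΓSpecIso (.of k)).inv.hom)).toAlgebra
  letI algA : Algebra k (X.presheaf.stalk x) := ((X.presheaf.germ ⊤ x trivial).hom.comp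
    (fX.appTop.hom.comp (Scheme.ΓSpecIso (.of k)).inv.hom)).toAlgebra
  haveI : IsScalarTower k (X.presheaf.stalk x) X.functionField := by
    refine IsScalarTower.of_algebraMap_eq fun c => ?_
    change X.presheaf.germ ⊤ (genericPoint X) trivial _ =
      algebraMap (X.presheaf.stalk x) X.functionField (X.presheaf.germ ⊤ x trivial _)
    haveI : Nonempty (⊤ : X.Opens) := ⟨⟨x, trivial⟩⟩
    rw [Scheme.algebraMap_germ_eq_germToFunctionField]
  haveI : Ring.KrullDimLE 1 (X.presheaf.stalk x) := krullDimLE_of_coheight_le hxc.le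
  rw [ord_eq_toAdd_ordFrac hxc, ordFrac_eq_one_of_isAlgebraic hf halg]
  rfl

end RatLeAlg

/-! ### The data of Fulton's Prop. 1.6: the closure of the graph of `f` in `X ×ₖ ℙ¹` -/

open MonoidalCategory CartesianMonoidalCategory

variable {k : Type u} [Field k] (X : SchemeOver k)

/-! #### Instances for `ℙ¹` in the `Over` spelling -/

namespace RatAlgData


/-- `ℙ¹` is integral (in the `Over` spelling). [folklore] -/
instance isIntegral_Pover_left : IsIntegral (ProjLine.Pover k).left :=
  inferInstanceAs (IsIntegral (ProjLine.P k))

/-- `ℙ¹ → Spec k` is smooth of relative dimension `1` (in the `Over` spelling). [folklore] -/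
instance smooth_Pover_hom : SmoothOfRelativeDimension 1 (ProjLine.Pover k).hom :=
  ProjLine.smoothOfRelativeDimension_one_toSpec k

/-- `ℙ¹ → Spec k` is proper (in the `Over` spelling). [folklore] -/
instance isProper_Pover_hom : IsProper (ProjLine.Pover k).hom := ProjLine.isProper_toSpec k

/-- `ℙ¹ → Spec k` is proper. [folklore] -/
instance isProper_toSpec : IsProper (Segre.toSpec (Fin 2) k) := ProjLine.isProper_toSpec k

/-- `ℙ¹ → Spec k` is locally of finite type. [folklore] -/
instance locallyOfFiniteType_Pover_hom : LocallyOfFiniteType (ProjLine.Pover k).hom :=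
  inferInstance

end RatAlgData

/-- **The data of the proof of Fulton's Prop. 1.6 (`Rat ⊆ Alg`, Example 10.3.2).** A closed
subvariety `V ⊆ X` of dimension `d + 1`, a rational function `f ≠ 0` on `V`, and the closure of the
graph of `f`: an integral scheme `src` with a proper birational `π : src → V` and a dominant
`ψ : src → ℙ¹` over `k` with `ψ^♯ t = π^♯ f` (as produced by
`Literature.AlgebraicGeometry.Motives.exists_graphClosure`). [cite: Fulton1998, Prop. 1.6 (proof)] -/
structure RatAlgData where
  /-- The subvariety `V ⊆ X`. -/
  V : ClosedSubvariety X.left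
  /-- The dimension of the cycles (`dim V = d + 1`). -/
  d : ℕ
  /-- `dim V = d + 1`. -/
  hV : V.dim = d + 1
  /-- The rational function `f ∈ R(V)`. -/
  f : V.carrier.functionField
  /-- `f ≠ 0`. -/
  hf : f ≠ 0
  /-- The closure of the graph of `f` (abstractly). -/
  src : Scheme.{u}
  [isIntegral_src : IsIntegral src]
  /-- The projection to `V` (proper, birational). -/
  π : src ⟶ V.carrier
  [isProper_π : IsProper π]
  [isDominant_π : IsDominant π]
  /-- The projection to `ℙ¹` (dominant; `ℙ¹` in the `Over` spelling `(ProjLine.Pover k).left`). -/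
  ψ : src ⟶ (ProjLine.Pover k).left
  [isDominant_ψ : IsDominant ψ]
  /-- `ψ` is a morphism over `k`. -/
  w : ψ ≫ (ProjLine.Pover k).hom = π ≫ V.ι ≫ X.hom
  /-- `π` is birational. -/
  bij : Function.Bijective (RatFn.functionFieldMap π)
  /-- `ψ^♯ t = π^♯ f`. -/
  hψt : RatFn.functionFieldMap ψ (ProjLine.t k) = RatFn.functionFieldMap π f

namespace RatAlgData

attribute [instance] isIntegral_src isProper_π isDominant_π isDominant_ψ

variable {X} (D : RatAlgData X)

/-! #### The morphism `src → X ×ₖ ℙ¹` and its image `W` -/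

/-- `(π, ψ) : src → X ×ₖ ℙ¹`. [folklore] -/
def m : D.src ⟶ (X ⊗ ProjLine.Pover k).left :=
  pullback.lift (D.π ≫ D.V.ι) D.ψ (by rw [Category.assoc, ← D.w])

/-- `(π, ψ) ≫ pr₁ = π ≫ ι_V`. [folklore] -/
@[reassoc]
theorem m_fst : D.m ≫ (fst X (ProjLine.Pover k)).left = D.π ≫ D.V.ι :=
  pullback.lift_fst _ _ _

/-- `(π, ψ) ≫ pr₂ = ψ`. [folklore] -/
@[reassoc]
theorem m_snd : D.m ≫ (snd X (ProjLine.Pover k)).left = D.ψ :=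
  pullback.lift_snd _ _ _

/-- `pr₁ : X ×ₖ ℙ¹ → X` is separated (base change of `ℙ¹ → Spec k`). [folklore] -/
scoped instance isSeparated_fst_left : IsSeparated (fst X (ProjLine.Pover k)).left :=
  inferInstanceAs (IsSeparated (pullback.fst X.hom (Segre.toSpec (Fin 2) k)))

/-- `pr₁ : X ×ₖ ℙ¹ → X` is proper (base change of `ℙ¹ → Spec k`). [folklore] -/
scoped instance isProper_fst_left : IsProper (fst X (ProjLine.Pover k)).left :=
  inferInstanceAs (IsProper (pullback.fst X.hom (Segre.toSpec (Fin 2) k)))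

/-- `(π, ψ) : src → X ×ₖ ℙ¹` is proper (`(π, ψ) ≫ pr₁ = π ≫ ι_V` is proper and `pr₁` is separated).
[folklore] -/
scoped instance isProper_m : IsProper D.m := by
  haveI : IsProper (D.m ≫ (fst X (ProjLine.Pover k)).left) := by rw [m_fst]; infer_instance
  exact IsProper.of_comp D.m (fst X (ProjLine.Pover k)).left

/-- The closure `W` of the graph of `f`, as a closed subscheme of `X ×ₖ ℙ¹` (scheme-theoretic image
of `(π, ψ)`; reducible, so that its carrier is syntactically the image scheme for instance search).
[folklore] -/
abbrev Zs : ClosedSubscheme (X ⊗ ProjLine.Pover k).left where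
  carrier := D.m.image
  ι := D.m.imageι

/-- The scheme-theoretic image `W` of the integral `src` is integral. [folklore] -/
scoped instance isIntegral_image : IsIntegral D.m.image := isIntegral_image_of_isIntegral D.m

/-- `W` is integral (as the carrier of `Zs`). [folklore] -/
scoped instance isIntegral_Zs_carrier : IsIntegral D.Zs.carrier := D.isIntegral_image

/-- `W ↪ X ×ₖ ℙ¹` is a closed immersion (as the immersion of `Zs`). [folklore] -/
scoped instance isClosedImmersion_Zs_ι : IsClosedImmersion D.Zs.ι :=
  inferInstanceAs (IsClosedImmersion D.m.imageι)

/-- The closure `W` of the graph of `f`, as a closed subvariety of `X ×ₖ ℙ¹` (reducible, like `Zs`).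
[folklore] -/
abbrev W : ClosedSubvariety (X ⊗ ProjLine.Pover k).left where
  carrier := D.m.image
  ι := D.m.imageι

/-- `W` as a closed subscheme is `Zs` (by `rfl`). [folklore] -/
theorem W_toClosedSubscheme : D.W.toClosedSubscheme = D.Zs := rfl

/-! #### The projection `p : W → V` -/

/-- The image of `W → X` lies in `V`. [folklore] -/
theorem range_imageι_fst_subset :
    Set.range (D.m.imageι ≫ (fst X (ProjLine.Pover k)).left) ⊆ closure (Set.range D.V.ι) := by
  have hd : DenseRange D.m.toImage := D.m.toImage.denseRange
  have hcont : Continuous (D.m.imageι ≫ (fst X (ProjLine.Pover k)).left) :=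
    (D.m.imageι ≫ (fst X (ProjLine.Pover k)).left).continuous
  have e : D.m.toImage ≫ (D.m.imageι ≫ (fst X (ProjLine.Pover k)).left) = D.π ≫ D.V.ι := by
    rw [Scheme.Hom.toImage_imageι_assoc, m_fst]
  rintro _ ⟨w, rfl⟩
  have hw : w ∈ closure (Set.range D.m.toImage) := by
    rw [hd.closure_range]; trivial
  have h2 : (D.m.imageι ≫ (fst X (ProjLine.Pover k)).left) w ∈
      closure ((D.m.imageι ≫ (fst X (ProjLine.Pover k)).left) '' Set.range D.m.toImage) :=
    image_closure_subset_closure_image hcont ⟨w, hw, rfl⟩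
  refine closure_mono ?_ h2
  rintro _ ⟨_, ⟨s, rfl⟩, rfl⟩
  refine ⟨D.π s, ?_⟩
  have h := congrArg (fun φ => φ s) e
  simp only [Scheme.Hom.comp_apply] at h ⊢
  exact h.symm

/-- **The projection `p : W → V`**: `W → X ×ₖ ℙ¹ → X` factors through the closed subvariety `V`
(`W` is reduced and maps into `V` set-theoretically: `Scheme.Hom.ker_le_ker_of_range_subset_closure`
of `Motives/AbelianVarietyKernelComponent`, Mathlib `IsClosedImmersion.lift`). [folklore] -/
def p : D.m.image ⟶ D.V.carrier :=
  IsClosedImmersion.lift D.V.ι (D.m.imageι ≫ (fst X (ProjLine.Pover k)).left)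
    (Scheme.Hom.ker_le_ker_of_range_subset_closure _ _ D.range_imageι_fst_subset)

/-- `p ≫ ι_V = ι_W ≫ pr₁`. [folklore] -/
@[reassoc]
theorem p_ι : D.p ≫ D.V.ι = D.m.imageι ≫ (fst X (ProjLine.Pover k)).left :=
  IsClosedImmersion.lift_fac _ _ _

/-- `src → W → V` is `π`. [folklore] -/
@[reassoc]
theorem toImage_p : D.m.toImage ≫ D.p = D.π := by
  rw [← cancel_mono D.V.ι, Category.assoc, p_ι, Scheme.Hom.toImage_imageι_assoc, m_fst]

/-- `p : W → V` is proper (`p ≫ ι_V = ι_W ≫ pr₁` is proper). [folklore] -/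
scoped instance isProper_p : IsProper D.p := by
  haveI : IsProper (D.p ≫ D.V.ι) := by rw [p_ι]; infer_instance
  exact IsProper.of_comp D.p D.V.ι

/-- `p : W → V` is dominant (`src → W → V` is `π`). [folklore] -/
scoped instance isDominant_p : IsDominant D.p := by
  haveI : IsDominant (D.m.toImage ≫ D.p) := by rw [toImage_p]; infer_instance
  exact IsDominant.of_comp D.m.toImage D.p

/-- The projection `g : W → ℙ¹` (reducible: it is `ι_W ≫ pr₂` syntactically for instance search).
[folklore] -/
abbrev g : D.m.image ⟶ (ProjLine.Pover k).left := D.m.imageι ≫ (snd X (ProjLine.Pover k)).left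

/-- Unfolding `g`. [folklore] -/
theorem g_def : D.g = D.m.imageι ≫ (snd X (ProjLine.Pover k)).left := rfl

/-- `src → W → ℙ¹` is `ψ`. [folklore] -/
@[reassoc]
theorem toImage_g : D.m.toImage ≫ D.g = D.ψ := by
  rw [g_def, Scheme.Hom.toImage_imageι_assoc]
  exact D.m_snd

/-- `g : W → ℙ¹` is dominant (`src → W → ℙ¹` is `ψ`). [folklore] -/
scoped instance isDominant_g : IsDominant D.g := by
  haveI : IsDominant (D.m.toImage ≫ D.g) := by rw [toImage_g]; infer_instance
  exact IsDominant.of_comp D.m.toImage D.g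

/-- `g : W → ℙ¹` is flat, as a dominant morphism from an integral scheme to a smooth curve
(`flat_of_isDominant_of_smoothCurve`; Hartshorne III.9.7). [folklore] -/
scoped instance flat_g : Flat D.g := flat_of_isDominant_of_smoothCurve (ProjLine.Pover k) D.g

/-- `W ↪ X ×ₖ ℙ¹ → ℙ¹` is flat (it is `g`). [folklore] -/
scoped instance flat_W_ι_snd : Flat (D.W.ι ≫ (snd X (ProjLine.Pover k)).left) := D.flat_g

/-- `Zs ↪ X ×ₖ ℙ¹ → ℙ¹` is flat (it is `g`). [folklore] -/
scoped instance flat_Zs_ι_snd : Flat (D.Zs.ι ≫ (snd X (ProjLine.Pover k)).left) := D.flat_g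

/-! #### Function fields: `p` is birational and `g^♯ t = p^♯ f` -/

/-- `functionFieldMap` only depends on the morphism (instance-insensitive congruence). [folklore] -/
theorem functionFieldMap_congr {A B : Scheme.{u}} [IsIntegral A] [IsIntegral B] {g g' : A ⟶ B}
    [IsDominant g] [IsDominant g'] (h : g = g') :
    RatFn.functionFieldMap g = RatFn.functionFieldMap g' := by
  subst h; rfl

/-- `π^♯ = toImage^♯ ∘ p^♯`. [folklore] -/
theorem functionFieldMap_π :
    RatFn.functionFieldMap D.π =
      (RatFn.functionFieldMap D.m.toImage).comp (RatFn.functionFieldMap D.p) := by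
  rw [← RatFn.functionFieldMap_comp, functionFieldMap_congr D.toImage_p]

/-- `ψ^♯ = toImage^♯ ∘ g^♯`. [folklore] -/
theorem functionFieldMap_ψ :
    RatFn.functionFieldMap D.ψ =
      (RatFn.functionFieldMap D.m.toImage).comp (RatFn.functionFieldMap D.g) := by
  rw [← RatFn.functionFieldMap_comp, functionFieldMap_congr D.toImage_g]

/-- **`p : W → V` is birational.** [folklore] -/
theorem bijective_functionFieldMap_p : Function.Bijective (RatFn.functionFieldMap D.p) := by
  have hcomp := D.functionFieldMap_π
  have hsurjA : Function.Surjective (RatFn.functionFieldMap D.m.toImage) := by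
    intro y
    obtain ⟨x, hx⟩ := D.bij.2 y
    exact ⟨RatFn.functionFieldMap D.p x, by rw [← RingHom.comp_apply, ← hcomp, hx]⟩
  refine ⟨RingHom.injective _, fun y => ?_⟩
  obtain ⟨x, hx⟩ := D.bij.2 (RatFn.functionFieldMap D.m.toImage y)
  refine ⟨x, (RatFn.functionFieldMap D.m.toImage).injective ?_⟩
  rw [← RingHom.comp_apply, ← hcomp, hx]

/-- The rational function `φ = g^♯ t` on `W`. [folklore] -/
def φ : D.m.image.functionField := RatFn.functionFieldMap D.g (ProjLine.t k)

/-- **`g^♯ t = p^♯ f`.** [folklore] -/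
theorem φ_eq : D.φ = RatFn.functionFieldMap D.p D.f := by
  apply (RatFn.functionFieldMap D.m.toImage).injective
  rw [φ, ← RingHom.comp_apply, ← functionFieldMap_ψ, D.hψt, ← RingHom.comp_apply,
    ← functionFieldMap_π]

/-- `φ ≠ 0`. [folklore] -/
theorem φ_ne_zero : D.φ ≠ 0 :=
  (map_ne_zero_iff _ (RingHom.injective _)).mpr (ProjLine.t_ne_zero k)

/-! #### Dimensions and Noetherian hypotheses -/

section FiniteType

variable [LocallyOfFiniteType X.hom]

/-- `X` is locally Noetherian (locally of finite type over a field). [folklore] -/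
scoped instance isLocallyNoetherian_X_left : IsLocallyNoetherian X.left :=
  LocallyOfFiniteType.isLocallyNoetherian X.hom

/-- `V` is locally Noetherian (locally of finite type over a field). [folklore] -/
scoped instance isLocallyNoetherian_V : IsLocallyNoetherian D.V.carrier :=
  LocallyOfFiniteType.isLocallyNoetherian (D.V.ι ≫ X.hom)

/-- `X ×ₖ ℙ¹ → Spec k` is locally of finite type. [folklore] -/
scoped instance locallyOfFiniteType_tensor_hom : LocallyOfFiniteType (X ⊗ ProjLine.Pover k).hom :=
  locallyOfFiniteType_tensorObj_hom_of_smoothCurve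

/-- `X ×ₖ ℙ¹` is locally Noetherian. [folklore] -/
scoped instance isLocallyNoetherian_tensor_left : IsLocallyNoetherian (X ⊗ ProjLine.Pover k).left :=
  LocallyOfFiniteType.isLocallyNoetherian (X ⊗ ProjLine.Pover k).hom

/-- `W` is locally Noetherian (a closed subscheme of `X ×ₖ ℙ¹`). [folklore] -/
scoped instance isLocallyNoetherian_image : IsLocallyNoetherian D.m.image :=
  LocallyOfFiniteType.isLocallyNoetherian D.m.imageι

/-- `W` is locally Noetherian (as the carrier of `Zs`). [folklore] -/
scoped instance isLocallyNoetherian_Zs : IsLocallyNoetherian D.Zs.carrier :=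
  D.isLocallyNoetherian_image

omit [LocallyOfFiniteType X.hom] in
/-- `dim V = d + 1` on `V` itself. [folklore] -/
theorem height_top_V : height (⊤ : D.V.carrier) = (D.d + 1 : ℕ) := by
  rw [← D.V.dim_eq_height_top, D.hV]
  push_cast
  rfl

/-- **`dim W = dim V = d + 1`** (birational invariance of dimension along `p`). [folklore] -/
theorem height_top_image : height (⊤ : D.m.image) = (D.d + 1 : ℕ) := by
  haveI : LocallyOfFiniteType (D.p ≫ D.V.ι ≫ X.hom) := inferInstance
  let ι := (Scheme.ΓSpecIso (.of k)).inv.hom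
  letI algV : Algebra k D.V.carrier.functionField :=
    ((D.V.carrier.presheaf.germ ⊤ (genericPoint D.V.carrier) trivial).hom.comp
      ((D.V.ι ≫ X.hom).appTop.hom.comp ι)).toAlgebra
  letI algW : Algebra k D.m.image.functionField :=
    ((D.m.image.presheaf.germ ⊤ (genericPoint D.m.image) trivial).hom.comp
      ((D.p ≫ D.V.ι ≫ X.hom).appTop.hom.comp ι)).toAlgebra
  let e : D.V.carrier.functionField ≃ₐ[k] D.m.image.functionField :=
    AlgEquiv.ofBijective
      { toRingHom := RatFn.functionFieldMap D.p
        commutes' := fun c =>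
          functionFieldMap_algebraMap_top (D.V.ι ≫ X.hom) D.p (D.p ≫ D.V.ι ≫ X.hom) rfl c }
      D.bijective_functionFieldMap_p
  rw [height_top_eq_of_algEquiv (D.V.ι ≫ X.hom) (D.p ≫ D.V.ι ≫ X.hom) e, height_top_V]

/-- `dim W = d + 1`, read in `X ×ₖ ℙ¹`. [folklore] -/
theorem W_dim : D.W.dim = D.d + 1 := by
  rw [D.W.dim_eq_height_top]
  change height (⊤ : D.m.image) = _
  rw [height_top_image]
  push_cast
  rfl

/-- `height (ι_W η_W) = d + 1`. [folklore] -/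
theorem height_ι_genericPoint : height (D.Zs.ι (genericPoint D.Zs.carrier)) = (D.d + 1 : ℕ) :=
  (height_base_eq_of_isClosedImmersion' D.Zs.ι (genericPoint D.Zs.carrier)).trans
    D.height_top_image

/-! #### The divisors of `φ` on `W` and of `f` on `V` -/

/-- The divisor `div(φ)` of `φ = g^♯ t` on `W`, as a cycle on `W`. [folklore] -/
def cW : AlgebraicCycle D.m.image ℤ where
  toFun z := Scheme.ord D.φ z
  supportWithinDomain' := Set.subset_univ _
  supportLocallyFiniteWithinDomain' z _ := locallyFiniteSupport_ord D.φ z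

/-- Coefficients of `cW`. [folklore] -/
@[simp] theorem cW_apply (z : D.m.image) : D.cW z = Scheme.ord D.φ z := rfl

/-- The divisor `div(f)` on `V`, as a cycle on `V`. [folklore] -/
def cV : AlgebraicCycle D.V.carrier ℤ where
  toFun v := Scheme.ord D.f v
  supportWithinDomain' := Set.subset_univ _
  supportLocallyFiniteWithinDomain' z _ := locallyFiniteSupport_ord D.f z

/-- Coefficients of `cV`. [folklore] -/
@[simp] theorem cV_apply (v : D.V.carrier) : D.cV v = Scheme.ord D.f v := rfl

/-- **`p_* div(p^♯ f) = div(f)`** (Stacks 02RT / Fulton Prop. 1.4 (b) for the birational proper `p`: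
`Nm(p^♯ f) = f` as `[R(W) : R(V)] = 1`). [cite: Fulton1998, Prop. 1.4 (b)] -/
theorem map_p_cW : AlgebraicCycle.map D.p height height D.cW = D.cV := by
  -- the `Over` spelling of `p : W → V`
  let Vo : SchemeOver k := Over.mk (D.V.ι ≫ X.hom)
  let Wo : SchemeOver k := Over.mk (D.p ≫ D.V.ι ≫ X.hom)
  let po : Wo ⟶ Vo := Over.homMk D.p rfl
  haveI : IsIntegral Wo.left := D.isIntegral_image
  haveI : IsIntegral Vo.left := D.V.isIntegral
  haveI : LocallyOfFiniteType Wo.hom :=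
    inferInstanceAs (LocallyOfFiniteType (D.p ≫ D.V.ι ≫ X.hom))
  haveI : LocallyOfFiniteType Vo.hom := inferInstanceAs (LocallyOfFiniteType (D.V.ι ≫ X.hom))
  haveI : IsLocallyNoetherian Wo.left := D.isLocallyNoetherian_image
  haveI : IsLocallyNoetherian Vo.left := D.isLocallyNoetherian_V
  haveI : IsProper po.left := D.isProper_p
  haveI : IsDominant po.left := D.isDominant_p
  have h := map_div_eq_div_norm_holds po (D.d + 1) D.height_top_image D.height_top_V D.φ
    D.φ_ne_zero D.cW rfl
  ext v
  refine (congrFun h v).trans ?_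
  rw [cV_apply]
  change Scheme.ord (RatFn.norm D.p D.φ) v = _
  congr 1
  rw [φ_eq]
  letI := (RatFn.functionFieldMap D.p).toAlgebra
  have hrank : Module.finrank D.V.carrier.functionField D.m.image.functionField = 1 := by
    have e := (AlgEquiv.ofBijective (Algebra.ofId D.V.carrier.functionField
      D.m.image.functionField) D.bijective_functionFieldMap_p).toLinearEquiv
    rw [← e.finrank_eq, Module.finrank_self]
  change RatFn.norm D.p (algebraMap D.V.carrier.functionField D.m.image.functionField D.f) = D.f
  rw [RatFn.norm_apply, Algebra.norm_algebraMap, hrank, pow_one]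

/-- **`(ι_V)_* div(f)` is the generator**: a cycle on `X` with coefficient function `V.divFun f` is the
push-forward of `div(f)` along the closed immersion `V ↪ X`. [folklore] -/
theorem map_ι_cV (c : AlgebraicCycle X.left ℤ) (hc : ⇑c = D.V.divFun D.f) :
    AlgebraicCycle.map D.V.ι height height D.cV = c := by
  ext x
  by_cases hx : x ∈ Set.range D.V.ι
  · obtain ⟨v, rfl⟩ := hx
    rw [map_apply_of_isClosedImmersion, cV_apply, hc, ClosedSubvariety.divFun_ι_base]
  · rw [map_apply_of_notMem_range _ _ _ hx, hc, ClosedSubvariety.divFun_of_notMem_range _ _ hx]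

/-- `AlgebraicCycle.map` only depends on the morphism (instance-insensitive congruence). [folklore] -/
theorem map_congr {A B : Scheme.{u}} {g g' : A ⟶ B} [QuasiCompact g] [QuasiCompact g']
    (c : AlgebraicCycle A ℤ) (h : g = g') :
    AlgebraicCycle.map g height height c = AlgebraicCycle.map g' height height c := by
  subst h; rfl

/-- `pr₁ : X ×ₖ ℙ¹ → X` is quasi-compact. [folklore] -/
scoped instance quasiCompact_fst_left : QuasiCompact (fst X (ProjLine.Pover k)).left :=
  inferInstance

/-- `W ↪ X ×ₖ ℙ¹ → X` is quasi-compact (so that cycles can be pushed forward along it). [folklore] -/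
scoped instance quasiCompact_ι_fst : QuasiCompact (D.Zs.ι ≫ (fst X (ProjLine.Pover k)).left) :=
  inferInstance

/-- **The generator is `(W → X)_* div(φ)`**: `c = (ι_V)_* div(f) = (ι_V)_* p_* div(φ) = (ι_W ≫ pr₁)_* div(φ)`.
[cite: Fulton1998, Prop. 1.6 (proof)] -/
theorem map_ι_fst_cW (c : AlgebraicCycle X.left ℤ) (hc : ⇑c = D.V.divFun D.f) :
    AlgebraicCycle.map (D.Zs.ι ≫ (fst X (ProjLine.Pover k)).left) height height D.cW = c := by
  rw [← D.map_ι_cV c hc, ← map_p_cW,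
    ← algebraicCycleMap_comp D.p D.V.ι D.p.isClosedMap D.V.ι.isClosedMap D.cW]
  exact map_congr D.cW D.p_ι.symm

/-! #### The hypotheses of the push-forward bookkeeping (`Motives/FamilyFiberCyclePushforward`) -/

/-- `div(φ)` is a `d`-cycle on `W`. [folklore] -/
theorem cW_mem_cyclesOfDim : D.cW ∈ cyclesOfDim D.m.image D.d := by
  intro z hz
  rw [cW_apply] at hz
  have hzc : coheight z = 1 := by
    by_contra h
    exact hz (Scheme.ord_eq_zero_of_coheight_neq_one h _)
  haveI : LocallyOfFiniteType (D.p ≫ D.V.ι ≫ X.hom) := inferInstance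
  exact Scheme.height_eq_of_coheight_eq (D.p ≫ D.V.ι ≫ X.hom) D.height_top_image hzc rfl

/-- The fibre cycles `[W_t]` are `d`-cycles. [folklore] -/
theorem familyFiberCycle_mem (t : AlgPoints (ProjLine.Pover k) k) :
    familyFiberCycle D.Zs t locallyFinsupp_fundamentalCycleFun_holds ∈ cyclesOfDim X.left D.d :=
  familyFiberCycle_mem_cyclesOfDim D.Zs D.height_ι_genericPoint t _

omit [LocallyOfFiniteType X.hom] in
/-- `g^♯` is compatible with the stalk maps of `g`. [folklore] -/
theorem functionFieldMap_g_algebraMap (z : D.m.image)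
    (a : (ProjLine.Pover k).left.presheaf.stalk (D.g.base z)) :
    RatFn.functionFieldMap D.g (algebraMap _ (ProjLine.Pover k).left.functionField a) =
      algebraMap _ D.m.image.functionField ((D.g.stalkMap z).hom a) :=
  RatFn.functionFieldMap_toFunctionField D.g z a

/-- A point of `W_t` over `z ∈ W` of dimension `d` has `z` of codimension one in `W`. [folklore] -/
theorem coheight_fst_eq_one (t : AlgPoints (ProjLine.Pover k) k) (w : (familyFiber D.Zs t).carrier)
    (hw : height ((familyFiber D.Zs t).ι.base w) = D.d) :
    coheight (pullback.fst D.Zs.ι (sliceAt X t).left w) = 1 := by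
  haveI := isClosedImmersion_sliceAt_left (X := X) t
  set z := pullback.fst D.Zs.ι (sliceAt X t).left w with hz_def
  have hz : height z = D.d := by
    rw [← height_apply_of_isClosedImmersion D.Zs.ι z, hz_def, ← sliceAt_familyFiber_ι_fst_apply,
      height_apply_of_isClosedImmersion (sliceAt X t).left]
    exact hw
  haveI : LocallyOfFiniteType (D.p ≫ D.V.ι ≫ X.hom) := inferInstance
  have h := Scheme.height_add_coheight_eq_height_top (D.p ≫ D.V.ι ≫ X.hom) z
  rw [hz, D.height_top_image, Nat.cast_add, Nat.cast_one] at h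
  exact WithTop.add_left_cancel (ENat.coe_ne_top _) h

/-- **Example 1.5.1 at `0` and `∞`**: at a point `w` of `W_{ptᵢ}` of dimension `d`, over `z ∈ W`,
the multiplicity of `[W_{ptᵢ}]` is `ord_z (g^♯ τᵢ)` (`τ₀ = t`, `τ₁ = t⁻¹`). [cite: Fulton1998, Example 1.5.1] -/
theorem familyFiberCycle_pt_apply (i : Fin 2) (w : (familyFiber D.Zs (ProjLine.pt k i)).carrier)
    (hw : height ((familyFiber D.Zs (ProjLine.pt k i)).ι.base w) = D.d) :
    familyFiberCycle D.Zs (ProjLine.pt k i) locallyFinsupp_fundamentalCycleFun_holds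
        ((familyFiber D.Zs (ProjLine.pt k i)).ι.base w) =
      Scheme.ord (RatFn.functionFieldMap D.g (ProjLine.τ k i))
        (pullback.fst D.Zs.ι (sliceAt X (ProjLine.pt k i)).left w) := by
  set z := pullback.fst D.Zs.ι (sliceAt X (ProjLine.pt k i)).left w with hz_def
  -- the point of `ℙ¹` under `z` is `yᵢ`
  have ha : (D.Zs.ι ≫ (snd X (ProjLine.Pover k)).left).base z = ProjLine.y k i :=
    snd_fst_familyFiber_apply D.Zs (ProjLine.pt k i) w
  obtain ⟨π, hπm, hπt⟩ := ProjLine.exists_uniformiser k i _ ha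
  have hco := D.coheight_fst_eq_one (ProjLine.pt k i) w hw
  -- the image of the uniformiser in `K(W)` is `g^♯ τᵢ ≠ 0`
  have hval : algebraMap _ D.m.image.functionField
      (((D.Zs.ι ≫ (snd X (ProjLine.Pover k)).left).stalkMap z).hom π) =
      RatFn.functionFieldMap D.g (ProjLine.τ k i) := by
    rw [← hπt]
    exact (D.functionFieldMap_g_algebraMap z π).symm
  have hne : ((D.Zs.ι ≫ (snd X (ProjLine.Pover k)).left).stalkMap z).hom π ≠ 0 := by
    intro h0
    have h1 : RatFn.functionFieldMap D.g (ProjLine.τ k i) = 0 := by rw [← hval, h0, map_zero]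
    exact (map_ne_zero_iff _ (RingHom.injective _)).mpr (ProjLine.τ_ne_zero k i) h1
  rw [familyFiberCycle_apply_eq_ord D.Zs (ProjLine.pt k i) _ w π hπm hco hne, hval]

/-- At the points of `W_0` of dimension `d`: `ord φ = ` multiplicity of `[W_0]`. [folklore] -/
theorem h_zero (w : (familyFiber D.Zs (ProjLine.pt k 0)).carrier)
    (hw : height ((familyFiber D.Zs (ProjLine.pt k 0)).ι.base w) = D.d) :
    Scheme.ord D.φ (pullback.fst D.Zs.ι (sliceAt X (ProjLine.pt k 0)).left w) =
      familyFiberCycle D.Zs (ProjLine.pt k 0) locallyFinsupp_fundamentalCycleFun_holds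
        ((familyFiber D.Zs (ProjLine.pt k 0)).ι.base w) := by
  rw [D.familyFiberCycle_pt_apply 0 w hw, ProjLine.τ_zero]
  rfl

/-- At the points of `W_∞` of dimension `d`: `ord φ = -` multiplicity of `[W_∞]`. [folklore] -/
theorem h_one (w : (familyFiber D.Zs (ProjLine.pt k 1)).carrier)
    (hw : height ((familyFiber D.Zs (ProjLine.pt k 1)).ι.base w) = D.d) :
    Scheme.ord D.φ (pullback.fst D.Zs.ι (sliceAt X (ProjLine.pt k 1)).left w) =
      -familyFiberCycle D.Zs (ProjLine.pt k 1) locallyFinsupp_fundamentalCycleFun_holds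
        ((familyFiber D.Zs (ProjLine.pt k 1)).ι.base w) := by
  have e2 : RatFn.functionFieldMap D.g (ProjLine.τ k 1) = D.φ⁻¹ := by
    rw [ProjLine.τ_one]
    exact map_inv₀ (RatFn.functionFieldMap D.g) (ProjLine.t k)
  rw [D.familyFiberCycle_pt_apply 1 w hw, e2, RatLeAlg.ord_inv D.φ_ne_zero, neg_neg]

/-- **`div(φ)` is supported over `0` and `∞`**: `t` is a unit at every other point of `ℙ¹`, so
`φ = g^♯ t` is a unit at every point of `W` over it. [cite: Fulton1998, Example 1.5.1] -/
theorem hoff (z : D.m.image) (hz : Scheme.ord D.φ z ≠ 0) :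
    (D.Zs.ι ≫ (snd X (ProjLine.Pover k)).left).base z =
        (ProjLine.pt k 0).toSpecHom.base (closedPoint k) ∨
      (D.Zs.ι ≫ (snd X (ProjLine.Pover k)).left).base z =
        (ProjLine.pt k 1).toSpecHom.base (closedPoint k) := by
  by_cases h0 : (D.Zs.ι ≫ (snd X (ProjLine.Pover k)).left).base z =
      (ProjLine.pt k 0).toSpecHom.base (closedPoint k)
  · exact Or.inl h0
  by_cases h1 : (D.Zs.ι ≫ (snd X (ProjLine.Pover k)).left).base z =
      (ProjLine.pt k 1).toSpecHom.base (closedPoint k)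
  · exact Or.inr h1
  exfalso
  obtain ⟨u, hu, hut⟩ := ProjLine.exists_isUnit_of_ne k h0 h1
  apply hz
  have e1 := congrArg (RatFn.functionFieldMap D.g) hut
  have e2 := D.functionFieldMap_g_algebraMap z u
  have hφ : D.φ = algebraMap _ D.m.image.functionField ((D.g.stalkMap z).hom u) :=
    e1.symm.trans e2
  rw [hφ]
  exact RatLeAlg.ord_algebraMap_of_isUnit _ (hu.map _)

/-- **`(ι_W ≫ pr₁)_* div(φ) = [W_0] - [W_∞]`** (Fulton §1.6 / Example 1.5.1,
`Motives/FamilyFiberCyclePushforward`). [cite: Fulton1998, Prop. 1.6 (proof)] -/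
theorem map_ι_fst_cW_eq_sub :
    AlgebraicCycle.map (D.Zs.ι ≫ (fst X (ProjLine.Pover k)).left) height height D.cW =
      familyFiberCycle D.Zs (ProjLine.pt k 0) locallyFinsupp_fundamentalCycleFun_holds -
        familyFiberCycle D.Zs (ProjLine.pt k 1) locallyFinsupp_fundamentalCycleFun_holds :=
  map_eq_familyFiberCycle_sub D.Zs locallyFinsupp_fundamentalCycleFun_holds D.φ D.cW
    (fun _ => rfl) D.cW_mem_cyclesOfDim (ProjLine.pt k 0) (ProjLine.pt k 1)
    (ProjLine.y_zero_ne_y_one k) (D.familyFiberCycle_mem _) (D.familyFiberCycle_mem _)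
    D.h_zero D.h_one D.hoff

/-- **Fulton, Prop. 1.6 / Example 10.3.2 for one generator**: the generator `[div(f)]` of `Rat_d X`
attached to `(V, f)` (with `f` transcendental over `k`) is the generator `[W_0] - [W_∞]` of
`Alg_d X` for the family `W ⊆ X ×ₖ ℙ¹`. [cite: Fulton1998, Prop. 1.6 and Example 10.3.2] -/
theorem mem_algTrivial (c : AlgebraicCycle X.left ℤ) (hcd : c ∈ cyclesOfDim X.left D.d)
    (hc : ⇑c = D.V.divFun D.f) : c ∈ algTrivial X D.d := by
  refine AddSubgroup.subset_closure ⟨hcd, inferInstance, locallyFinsupp_fundamentalCycleFun_holds,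
    ProjLine.Pover k, inferInstance, inferInstance, D.W, D.flat_W_ι_snd, ProjLine.pt k 0,
    ProjLine.pt k 1, D.W_dim, ?_⟩
  change c = familyFiberCycle D.Zs (ProjLine.pt k 0) _ - familyFiberCycle D.Zs (ProjLine.pt k 1) _
  rw [← map_ι_fst_cW_eq_sub, D.map_ι_fst_cW c hc]

end FiniteType

end RatAlgData

/-! ### `Rat_d X ≤ Alg_d X` -/

/-- **Discharge of `Literature.AlgebraicGeometry.Motives.ratTrivial_le_algTrivial` (Fulton,
*Intersection Theory*, Prop. 1.6 with §1.6 and Example 10.3.2: `Rat_d X ≤ Alg_d X`).** On a scheme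
`X` locally of finite type over a field `k`, every `d`-cycle rationally equivalent to zero is
algebraically equivalent to zero. Printed proof, followed here: a generator `[div(f)]`, `f ∈ R(V)^*`,
`V ⊆ X` a `(d+1)`-dimensional subvariety, is — for `f` transcendental over `k` — the difference
`[W_0] - [W_∞]` of the fibres over `0 = (1:0)` and `∞ = (0:1)` of the closure `W ⊆ X × ℙ¹` of the
graph of `f` (Prop. 1.6: `[div(f)] = p_*[div(p^♯ f)]` by Prop. 1.4 (b) for the birational `p : W → V`,
`[div(t∘g)] = [g⁻¹(0)] - [g⁻¹(∞)]` by Example 1.5.1, and `p_*[g⁻¹(P)] = [W(P)]`, §1.6), which is a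
generator of `Alg_d X` (`T = ℙ¹`, `W` flat over `ℙ¹` as it dominates it); for `f` algebraic over `k`
all orders of vanishing are zero (Prop. 1.4 (a), algebraic case) and the generator vanishes.
[cite: Fulton1998, Prop. 1.6, §1.6, Example 10.3.2] -/
theorem ratTrivial_le_algTrivial_holds :
    ∀ {K : Type u} [Field K] (X : SchemeOver K) [LocallyOfFiniteType X.hom] (d : ℕ),
      ratTrivial_le_algTrivial X d := by
  intro k _ X _ d
  change ratTrivial X.left d ≤ algTrivial X d
  rw [ratTrivial, AddSubgroup.closure_le]
  rintro c ⟨hcd, V, hVn, f, hf, hV, hc⟩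
  haveI := hVn
  letI alg : Algebra k V.carrier.functionField :=
    ((V.carrier.presheaf.germ ⊤ (genericPoint V.carrier) trivial).hom.comp
      ((V.ι ≫ X.hom).appTop.hom.comp (Scheme.ΓSpecIso (.of k)).inv.hom)).toAlgebra
  by_cases htr : Transcendental k f
  · obtain ⟨X', hX'i, π, hπp, hπd, ψ, hψd, hψS, hπbij, hψt⟩ :=
      exists_graphClosure (V.ι ≫ X.hom) f hf htr (Segre.toSpec (Fin 2) k) (ProjLine.t k)
        (fun U _ _ u a => ⟨ProjLine.ρ u a, ProjLine.ρ_toSpec u a, ProjLine.isDominant_ρ u a,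
          ProjLine.functionFieldMap_ρ_t u a⟩)
    let D : RatAlgData X :=
      { V := V, d := d, hV := hV, f := f, hf := hf, src := X', isIntegral_src := hX'i, π := π,
        isProper_π := hπp, isDominant_π := hπd, ψ := ψ, isDominant_ψ := hψd, w := hψS,
        bij := hπbij, hψt := hψt }
    exact D.mem_algTrivial c hcd hc
  · -- `f` algebraic over `k`: every order of vanishing is zero, so the generator vanishes
    have halg : IsAlgebraic k f := not_not.mp htr
    haveI : IsLocallyNoetherian V.carrier := hVn
    have hc0 : c = 0 := by
      ext x
      rw [hc]
      by_cases hx : x ∈ Set.range V.ι.base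
      · obtain ⟨v, rfl⟩ := hx
        rw [ClosedSubvariety.divFun_ι_base,
          RatLeAlg.ord_eq_zero_of_isAlgebraic_base (V.ι ≫ X.hom) f hf halg v]
        rfl
      · rw [ClosedSubvariety.divFun_of_notMem_range _ _ hx]
        rfl
    rw [hc0]
    exact zero_mem _

end Literature.AlgebraicGeometry.Motives

end
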